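import Mathlib
import Summits.Ventures.PercRepro2.GenTail

/-!
# Composition calculus of packing tails: SUM-type (convolution) and MIN-type (product)
compositions (seat mine-b, cell pub-perc-repro2)

With `genIn` / `genTail` of `GenTail.lean`: a SUM-type composition of two disjoint parts (`k`
witnesses in the union ⟺ `j` in `E₁` and `k − j` in `E₂`, the hypothesis `hsum`) has the
convolution of the two tails (`prob_genIn_sum_eq_sum`, `genTail_sum_eq_Hsum` = `IFR.Hsum`), hence
a log-concave tail when both parts have one (`isLCTail_genTail_sum`, by `IFR.Hsum_isLCTail`); a
MIN-type composition (`k` in the union ⟺ `k` in both parts, `hmin`) has the product of the two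
tails (`genTail_min_eq_mul`), hence a log-concave tail when both parts have one
(`isLCTail_genTail_min`, by `IFR.mul_isLCTail`).  Parallel composition of flows and series
composition of closed cuts are SUM-type; series composition of flows and parallel composition of
closed cuts are MIN-type.
-/

open Finset

namespace Summit.Ventures.PercRepro2

open IFR

section Sum

variable {E : Type*} [Fintype E] [DecidableEq E]

/-- on the level `= j` of the first part, the union is at level `≥ k` iff the second part is at
level `≥ k − j` (for a SUM-type composition) -/
theorem genLevel_inter_genIn_sum {A A₁ A₂ : Finset E → Prop} {E₁ E₂ : Finset E}
    (hsum : ∀ (k : ℕ) (ω : Config E), ω ∈ genIn A (E₁ ∪ E₂) k ↔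
      ∃ j ≤ k, ω ∈ genIn A₁ E₁ j ∧ ω ∈ genIn A₂ E₂ (k - j)) (k j : ℕ) :
    genLevel A₁ E₁ j ∩ genIn A (E₁ ∪ E₂) k = genLevel A₁ E₁ j ∩ genIn A₂ E₂ (k - j) := by
  ext ω
  simp only [Set.mem_inter_iff, genLevel, Set.mem_sdiff]
  constructor
  · rintro ⟨⟨hj, hj1⟩, hk⟩
    refine ⟨⟨hj, hj1⟩, ?_⟩
    obtain ⟨i, hi, h₁, h₂⟩ := (hsum k ω).1 hk
    have hij : i ≤ j := by
      by_contra hlt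
      exact hj1 (genIn_anti A₁ E₁ (Nat.lt_of_not_le hlt) h₁)
    exact genIn_anti A₂ E₂ (by omega) h₂
  · rintro ⟨⟨hj, hj1⟩, h₂⟩
    refine ⟨⟨hj, hj1⟩, ?_⟩
    rw [hsum k ω]
    refine ⟨min j k, min_le_right _ _, genIn_anti A₁ E₁ (min_le_left _ _) hj, ?_⟩
    have e : k - min j k = k - j := by omega
    rw [e]; exact h₂

/-- **the convolution identity** for a SUM-type composition of two disjoint parts -/
theorem prob_genIn_sum_eq_sum (p : E → ℝ) {A A₁ A₂ : Finset E → Prop} (hA₁0 : ¬ A₁ ∅)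
    {E₁ E₂ : Finset E} (hdisj : Disjoint E₁ E₂)
    (hsum : ∀ (k : ℕ) (ω : Config E), ω ∈ genIn A (E₁ ∪ E₂) k ↔
      ∃ j ≤ k, ω ∈ genIn A₁ E₁ j ∧ ω ∈ genIn A₂ E₂ (k - j)) (k : ℕ) :
    prob p (genIn A (E₁ ∪ E₂) k)
      = ∑ j ∈ Finset.range (E₁.card + 1), prob p (genLevel A₁ E₁ j) * prob p (genIn A₂ E₂ (k - j)) := by
  have h0 : prob p (genIn A (E₁ ∪ E₂) k)
      = prob p (genIn A (E₁ ∪ E₂) k ∩ (genIn A₁ E₁ (E₁.card + 1))ᶜ) := by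
    rw [genIn_eq_empty hA₁0 E₁ (Nat.lt_succ_self _), Set.compl_empty, Set.inter_univ]
  rw [h0, prob_inter_compl_genIn_eq_sum]
  refine Finset.sum_congr rfl fun j _ => ?_
  rw [Set.inter_comm, genLevel_inter_genIn_sum hsum k j]
  exact prob_inter_eq_mul_of_dependsOn p (Finset.disjoint_coe.2 hdisj)
    (dependsOn_genLevel A₁ E₁ j) (dependsOn_genIn A₂ E₂ (k - j))

/-- the tail of a SUM-type composition is `IFR.Hsum` of the tails of the parts -/
theorem genTail_sum_eq_Hsum (p : E → ℝ) {A A₁ A₂ : Finset E → Prop} (hA₁0 : ¬ A₁ ∅)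
    {E₁ E₂ : Finset E} (hdisj : Disjoint E₁ E₂)
    (hsum : ∀ (k : ℕ) (ω : Config E), ω ∈ genIn A (E₁ ∪ E₂) k ↔
      ∃ j ≤ k, ω ∈ genIn A₁ E₁ j ∧ ω ∈ genIn A₂ E₂ (k - j))
    {M : ℤ} (hM : (E₁.card : ℤ) + 1 ≤ M) (k : ℤ) :
    genTail p A (E₁ ∪ E₂) k = Hsum (genTail p A₂ E₂) (genTail p A₁ E₁) M k := by
  have hnat : ∀ n : ℕ, genTail p A (E₁ ∪ E₂) (n : ℤ)
      = Hsum (genTail p A₂ E₂) (genTail p A₁ E₁) M (n : ℤ) := by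
    intro n
    rw [genTail_natCast, prob_genIn_sum_eq_sum p hA₁0 hdisj hsum n]
    unfold Hsum
    have hsub : (Finset.range (E₁.card + 1)).image (Nat.cast : ℕ → ℤ) ⊆ I M := by
      intro x hx
      rw [Finset.mem_image] at hx
      obtain ⟨j, hj, rfl⟩ := hx
      rw [Finset.mem_range] at hj
      unfold I; rw [Finset.mem_Icc]; omega
    rw [← Finset.sum_subset hsub, Finset.sum_image (fun _ _ _ _ h => Nat.cast_injective h)]
    · refine Finset.sum_congr rfl fun j _ => ?_
      rw [pmf_genTail]
      congr 1
      by_cases hjk : j ≤ n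
      · have e : ((n : ℤ) - (j : ℤ)) = ((n - j : ℕ) : ℤ) := by omega
        rw [e, genTail_natCast]
      · have hlt : n < j := Nat.lt_of_not_le hjk
        rw [genTail_of_nonpos _ _ _ (by omega), Nat.sub_eq_zero_of_le hlt.le, genIn_zero, prob_univ]
    · intro x hxI hx
      have hx' : ∀ j ∈ Finset.range (E₁.card + 1), (j : ℤ) ≠ x := by
        intro j hj h
        exact hx (Finset.mem_image.2 ⟨j, hj, h⟩)
      rcases lt_or_ge x 0 with hneg | hpos
      · rw [IsLCTail.pmf, genTail_of_nonpos _ _ _ (by omega), genTail_of_nonpos _ _ _ (by omega)]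
        ring
      · have hbig : (E₁.card : ℤ) + 1 ≤ x := by
          by_contra hlt
          have hlt' : x < (E₁.card : ℤ) + 1 := not_le.1 hlt
          have hxn : x = ((x.toNat : ℕ) : ℤ) := (Int.toNat_of_nonneg hpos).symm
          apply hx' x.toNat (by rw [Finset.mem_range]; omega)
          exact hxn.symm
        rw [IsLCTail.pmf, genTail_eq_zero hA₁0 E₁ hbig, genTail_eq_zero hA₁0 E₁ (by omega)]
        ring
  rcases le_or_gt k 0 with hk | hk
  · have h0 := hnat 0
    simp only [Nat.cast_zero] at h0
    rw [genTail_of_nonpos _ _ _ le_rfl] at h0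
    rw [genTail_of_nonpos _ _ _ hk, h0]
    unfold Hsum
    refine Finset.sum_congr rfl fun x _ => ?_
    rcases le_or_gt x (-1) with hx | hx
    · rw [IsLCTail.pmf, genTail_of_nonpos _ _ _ (by omega), genTail_of_nonpos _ _ _ (by omega)]
      ring
    · rw [genTail_of_nonpos _ _ _ (by omega), genTail_of_nonpos _ _ _ (by omega)]
  · have e : k = ((k.toNat : ℕ) : ℤ) := (Int.toNat_of_nonneg hk.le).symm
    rw [e]
    exact hnat _

/-- **a SUM-type composition of two parts with log-concave tails has a log-concave tail** -/
theorem isLCTail_genTail_sum (p : E → ℝ) {A A₁ A₂ : Finset E → Prop} (hA0 : ¬ A ∅) (hA₁0 : ¬ A₁ ∅)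
    {E₁ E₂ : Finset E} (hdisj : Disjoint E₁ E₂)
    (hsum : ∀ (k : ℕ) (ω : Config E), ω ∈ genIn A (E₁ ∪ E₂) k ↔
      ∃ j ≤ k, ω ∈ genIn A₁ E₁ j ∧ ω ∈ genIn A₂ E₂ (k - j))
    (h₁ : IsLCTail (genTail p A₁ E₁) ((E₁.card : ℤ) + 1))
    (h₂ : IsLCTail (genTail p A₂ E₂) ((E₂.card : ℤ) + 1)) :
    IsLCTail (genTail p A (E₁ ∪ E₂)) (((E₁ ∪ E₂).card : ℤ) + 1) := by
  have hfun : genTail p A (E₁ ∪ E₂)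
      = Hsum (genTail p A₂ E₂) (genTail p A₁ E₁) ((E₁.card : ℤ) + 2) :=
    funext fun k => genTail_sum_eq_Hsum p hA₁0 hdisj hsum (M := (E₁.card : ℤ) + 2) (by omega) k
  have h := Hsum_isLCTail h₂ h₁ (M := (E₁.card : ℤ) + 2) (by omega) (by omega)
  rw [hfun]
  exact ⟨h.one, h.nonneg, h.anti, h.lc, fun k hk => by
    rw [← hfun]
    exact genTail_eq_zero hA0 (E₁ ∪ E₂) hk⟩

end Sum

section Min

variable {E : Type*} [Fintype E] [DecidableEq E]

/-- **the product identity** for a MIN-type composition of two disjoint parts -/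
theorem prob_genIn_min_eq_mul (p : E → ℝ) {A A₁ A₂ : Finset E → Prop} {E₁ E₂ : Finset E}
    (hdisj : Disjoint E₁ E₂)
    (hmin : ∀ (k : ℕ) (ω : Config E), ω ∈ genIn A (E₁ ∪ E₂) k ↔
      ω ∈ genIn A₁ E₁ k ∧ ω ∈ genIn A₂ E₂ k) (k : ℕ) :
    prob p (genIn A (E₁ ∪ E₂) k) = prob p (genIn A₁ E₁ k) * prob p (genIn A₂ E₂ k) := by
  have h : genIn A (E₁ ∪ E₂) k = genIn A₁ E₁ k ∩ genIn A₂ E₂ k := by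
    ext ω; exact hmin k ω
  rw [h]
  exact prob_inter_eq_mul_of_dependsOn p (Finset.disjoint_coe.2 hdisj)
    (dependsOn_genIn A₁ E₁ k) (dependsOn_genIn A₂ E₂ k)

/-- the tail of a MIN-type composition is the pointwise product of the tails of the parts -/
theorem genTail_min_eq_mul (p : E → ℝ) {A A₁ A₂ : Finset E → Prop} {E₁ E₂ : Finset E}
    (hdisj : Disjoint E₁ E₂)
    (hmin : ∀ (k : ℕ) (ω : Config E), ω ∈ genIn A (E₁ ∪ E₂) k ↔
      ω ∈ genIn A₁ E₁ k ∧ ω ∈ genIn A₂ E₂ k) :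
    genTail p A (E₁ ∪ E₂) = fun k => genTail p A₁ E₁ k * genTail p A₂ E₂ k := by
  funext k
  rcases le_or_gt k 0 with hk | hk
  · rw [genTail_of_nonpos _ _ _ hk, genTail_of_nonpos _ _ _ hk, genTail_of_nonpos _ _ _ hk]
    ring
  · rw [genTail_of_pos _ _ _ hk, genTail_of_pos _ _ _ hk, genTail_of_pos _ _ _ hk,
      prob_genIn_min_eq_mul p hdisj hmin]

/-- a log-concave tail with support bound `N` is one with any larger bound -/
theorem IFR.IsLCTail.of_le' {F : ℤ → ℝ} {N N' : ℤ} (h : IsLCTail F N) (hN : N ≤ N') : IsLCTail F N' :=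
  ⟨h.one, h.nonneg, h.anti, h.lc, fun k hk => h.vanish k (le_trans hN hk)⟩

/-- **a MIN-type composition of two parts with log-concave tails has a log-concave tail** -/
theorem isLCTail_genTail_min (p : E → ℝ) {A A₁ A₂ : Finset E → Prop} {E₁ E₂ : Finset E}
    (hdisj : Disjoint E₁ E₂)
    (hmin : ∀ (k : ℕ) (ω : Config E), ω ∈ genIn A (E₁ ∪ E₂) k ↔
      ω ∈ genIn A₁ E₁ k ∧ ω ∈ genIn A₂ E₂ k)
    (h₁ : IsLCTail (genTail p A₁ E₁) ((E₁.card : ℤ) + 1))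
    (h₂ : IsLCTail (genTail p A₂ E₂) ((E₂.card : ℤ) + 1)) :
    IsLCTail (genTail p A (E₁ ∪ E₂)) (((E₁ ∪ E₂).card : ℤ) + 1) := by
  rw [genTail_min_eq_mul p hdisj hmin]
  refine (mul_isLCTail h₁ h₂).of_le' ?_
  have h := Finset.card_le_card (Finset.subset_union_left (s₁ := E₁) (s₂ := E₂))
  rw [min_le_iff]
  left
  omega

end Min

end Summit.Ventures.PercRepro2
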